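import Literature.Probability.Percolation.GladkovZiminKernel
import HarnessLib

/-!
# Gladkov–Zimin Harris–Kleitman-type inequalities, COPOSITIVE form (the strength of their Theorem 4.3 /
# complete-positivity test)

Topic `Literature/Probability/Percolation`, in the finitary weighted-cube language of `DecisionTreeWeighted.lean`
/ `GladkovZiminKernel.lean` (`wtW`, `ED`, `classMass`).

## Source

N. Gladkov, A. Zimin, *On Harris–Kleitman type inequalities*, unpublished draft (September 2024)
[GladkovZimin2024HK].  Theorem 2.3 there (tree: `DecisionTree.kernel_classMass_le`) says: for a labelling
`π` of the cube monotone into a poset `P` and a kernel `A` with `A a d + A b c ≤ A a c + A b d` (`a ≤ b`, `c ≤ d`),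
`Σ_{a,b} A_ab m_a m_b ≤ Σ_a A_aa m_a` for the class masses `m_a = μ(π = a)` of every product measure `μ`.
Theorem 4.3 / Proposition 4.4 there state the COMPLETE-POSITIVITY form of the same phenomenon:
`diag(m) − m mᵀ = F M Fᵀ` with `F` the incidence matrix of comparable pairs (`−1` at the smaller, `+1` at the
larger end) and `M` entrywise nonnegative, indeed completely positive; by cone duality this upgrades Theorem 2.3
from kernels whose pair-kernel `K_A((a,b),(c,d)) := A a c + A b d − A a d − A b c` (`a ≤ b`, `c ≤ d`) is
entrywise NONNEGATIVE to kernels whose pair-kernel is merely COPOSITIVE (nonnegative as a quadratic form on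
nonnegative vectors) — e.g. `K_A = N + Σ_r g_r ⊗ g_r` with `N ≥ 0` (positive semidefinite plus nonnegative).

## What is proved here (all PROVED, no named facts, no sorries)

* `PairCopositive ι A` — the copositivity hypothesis, in the finitary form the induction consumes: for every
  finite family of comparable pairs `lo S ≤ hi S` indexed by configurations `S : Finset ι` with weights
  `w S ≥ 0`, `0 ≤ Σ_{S,T} w_S w_T · (A (lo S) (lo T) + A (hi S) (hi T) − A (lo S) (hi T) − A (hi S) (lo T))`;
* `pairCopositive_of_cross` — the pointwise (Theorem 2.3) condition implies it;
  `pairCopositive_of_gram` — a decomposition `A a c + A b d − A a d − A b c = N a b c d + Σ_{i ∈ r} L a b i · L c d i`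
  on comparable pairs with `N ≥ 0` (pair-indexed Gram part + nonnegative part) implies it (the "PSD + nonnegative" certificates);
* **`ED_ED_le_ED_diag_of_pairCopositive`** — the two-copy inequality
  `E_{μ×μ} A(π S, π T) ≤ E_μ A(π S, π S)` for every `⊆`-monotone labelling `π` and every `p ∈ [0,1]^ι`,
  under `PairCopositive ι A` (Theorem 2.1/2.3's induction on coordinates, the mixed sections now being
  dominated IN SUM rather than pointwise);
* `kernel_sum_sum_le_sum_of_pairCopositive`, **`kernel_classMass_le_of_pairCopositive`** — the same with the
  sums written out / on class masses: `Σ_{a,b ∈ t} A a b · m_a m_b ≤ Σ_{a ∈ t} A a a · m_a`.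
Proof of the two-copy inequality: induction on `D`; at `D = insert e D'`, with `X_ij` the four sections of the
two-copy average and `Y_i` the two sections of the diagonal average (as in `ED_ED_le_ED_diag`),
`(1−q)²X₀₀ + q(1−q)(X₀₁+X₁₀) + q²X₁₁ ≤ (1−q)X₀₀ + qX₁₁ ≤ (1−q)Y₀ + qY₁`, where the first step is
`X₀₀ + X₁₁ − X₀₁ − X₁₀ = Σ_{S,T ⊆ D'} w_S w_T K_A((π S, π(S+e)),(π T, π(T+e))) ≥ 0` — copositivity applied to the
family `lo = π`, `hi = π ∘ insert e`, `w = wtW D' p` — and the second is the induction hypothesis for `π` and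
for the shifted (still monotone) labelling `π ∘ insert e`.  This is the draft's Theorem 4.3 read through cone
duality (its matrix `M` is built by exactly this recursion: `M = (1−q)M₀ + qM₁ + q(1−q) u uᵀ`, `u ≥ 0`).

Why this file exists (project use): the certificate searches for the three-relay rung of
`Summits/CriticalPhenomena/PercolationContinuityZ3` (crux `NoHeavyLowerTail`, memo run/shared/lean/prim/
prim-gen-kcluster/KCLUSTER-gen6.md, ineq-harness) use "GZ rows" = the cone of Theorem 2.3; the copositive
(in practice: PSD + nonnegative, found by a semidefinite programme) cone is strictly larger and this file is its
semantic lemma.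

## References
* N. Gladkov, A. Zimin, *On Harris–Kleitman type inequalities*, unpublished draft, September 2024, Thms. 2.1,
  2.3, 4.3, Prop. 4.4. [GladkovZimin2024HK]
-/

noncomputable section

namespace Literature.Probability.Percolation

namespace DecisionTree

open Finset

variable {ι : Type*} [DecidableEq ι]

/-! ### The copositivity hypothesis and two sufficient conditions -/

/-- **Copositivity of the pair kernel of `A` along the cube.**  For every finite family of comparable pairs
`lo S ≤ hi S` indexed by configurations, with nonnegative weights `w`, the quadratic form
`Σ_{S,T} w_S w_T (A (lo S) (lo T) + A (hi S) (hi T) − A (lo S) (hi T) − A (hi S) (lo T))` is nonnegative.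
[cite: GladkovZimin2024HK, Thm. 4.3 / Prop. 4.4 (cone-dual form)] -/
def PairCopositive (ι : Type*) {κ : Type*} [Preorder κ] (A : κ → κ → ℝ) : Prop :=
  ∀ (s : Finset (Finset ι)) (w : Finset ι → ℝ) (lo hi : Finset ι → κ),
    (∀ S ∈ s, 0 ≤ w S) → (∀ S ∈ s, lo S ≤ hi S) →
      0 ≤ ∑ S ∈ s, ∑ T ∈ s,
        w S * w T * (A (lo S) (lo T) + A (hi S) (hi T) - A (lo S) (hi T) - A (hi S) (lo T))

omit [DecidableEq ι] in
/-- The pointwise condition of Theorem 2.3 (`A a d + A b c ≤ A a c + A b d` for `a ≤ b`, `c ≤ d`) implies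
copositivity: every summand is nonnegative. [cite: GladkovZimin2024HK, Thm. 2.3] -/
theorem pairCopositive_of_cross {κ : Type*} [Preorder κ] (A : κ → κ → ℝ)
    (hA : ∀ ⦃a b c d : κ⦄, a ≤ b → c ≤ d → A a d + A b c ≤ A a c + A b d) :
    PairCopositive ι A := by
  intro s w lo hi hw hle
  refine Finset.sum_nonneg fun S hS => Finset.sum_nonneg fun T hT => ?_
  have h := hA (hle S hS) (hle T hT)
  have hww : 0 ≤ w S * w T := mul_nonneg (hw S hS) (hw T hT)
  exact mul_nonneg hww (by linarith)

omit [DecidableEq ι] in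
/-- **PSD + nonnegative certificates.**  If on comparable pairs the pair kernel decomposes as
`A a c + A b d − A a d − A b c = N a b c d + Σ_{i ∈ r} L a b i · L c d i` with `N ≥ 0` (a Gram part indexed by the PAIRS plus an
entrywise-nonnegative part — e.g. obtained from a split `Fᵀ A F = L Lᵀ + N` on the covers, extended to comparable pairs along chains),
then `A` is pair-copositive: the double sum is `Σ w w N + Σ_i (Σ_S w_S · L (lo S) (hi S) i)² ≥ 0`.
[cite: GladkovZimin2024HK, Thm. 4.3 / Prop. 4.4 (doubly-nonnegative relaxation of complete positivity)] -/
theorem pairCopositive_of_gram {κ : Type*} [Preorder κ] (A : κ → κ → ℝ) {ρ : Type*} (r : Finset ρ)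
    (L : κ → κ → ρ → ℝ) (N : κ → κ → κ → κ → ℝ)
    (hN : ∀ ⦃a b c d : κ⦄, a ≤ b → c ≤ d → 0 ≤ N a b c d)
    (hdec : ∀ ⦃a b c d : κ⦄, a ≤ b → c ≤ d →
      A a c + A b d - A a d - A b c = N a b c d + ∑ i ∈ r, L a b i * L c d i) :
    PairCopositive ι A := by
  intro s w lo hi hw hle
  have hterm : ∀ S ∈ s, ∀ T ∈ s,
      w S * w T * (A (lo S) (lo T) + A (hi S) (hi T) - A (lo S) (hi T) - A (hi S) (lo T)) =
        w S * w T * N (lo S) (hi S) (lo T) (hi T) +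
          ∑ i ∈ r, (w S * L (lo S) (hi S) i) * (w T * L (lo T) (hi T) i) := by
    intro S hS T hT
    have h := hdec (hle S hS) (hle T hT)
    rw [h, mul_add, Finset.mul_sum]
    congr 1
    exact Finset.sum_congr rfl fun i _ => by ring
  rw [Finset.sum_congr rfl fun S hS => Finset.sum_congr rfl fun T hT => hterm S hS T hT]
  simp only [Finset.sum_add_distrib]
  have hsq : ∑ S ∈ s, ∑ T ∈ s, ∑ i ∈ r, (w S * L (lo S) (hi S) i) * (w T * L (lo T) (hi T) i) =
      ∑ i ∈ r, (∑ S ∈ s, w S * L (lo S) (hi S) i) ^ 2 := by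
    symm
    calc ∑ i ∈ r, (∑ S ∈ s, w S * L (lo S) (hi S) i) ^ 2
        = ∑ i ∈ r, ∑ S ∈ s, ∑ T ∈ s, (w S * L (lo S) (hi S) i) * (w T * L (lo T) (hi T) i) := by
          refine Finset.sum_congr rfl fun i _ => ?_
          rw [sq, Finset.sum_mul_sum]
      _ = ∑ S ∈ s, ∑ i ∈ r, ∑ T ∈ s, (w S * L (lo S) (hi S) i) * (w T * L (lo T) (hi T) i) := Finset.sum_comm
      _ = ∑ S ∈ s, ∑ T ∈ s, ∑ i ∈ r, (w S * L (lo S) (hi S) i) * (w T * L (lo T) (hi T) i) :=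
          Finset.sum_congr rfl fun S _ => Finset.sum_comm
  rw [hsq]
  have h1 : 0 ≤ ∑ S ∈ s, ∑ T ∈ s, w S * w T * N (lo S) (hi S) (lo T) (hi T) :=
    Finset.sum_nonneg fun S hS => Finset.sum_nonneg fun T hT =>
      mul_nonneg (mul_nonneg (hw S hS) (hw T hT)) (hN (hle S hS) (hle T hT))
  have h2 : 0 ≤ ∑ i ∈ r, (∑ S ∈ s, w S * L (lo S) (hi S) i) ^ 2 :=
    Finset.sum_nonneg fun i _ => sq_nonneg _
  linarith

/-! ### The two-copy inequality under copositivity -/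

/-- **Two-copy kernel inequality, copositive form** (the strength of Gladkov–Zimin's Thm. 4.3).  For
`p ∈ [0,1]^ι`, a kernel `A` that is pair-copositive along the cube, and every labelling `π` monotone along `⊆`
into a preorder: `E_{μ×μ} A(π S, π T) ≤ E_μ A(π S, π S)`.
[cite: GladkovZimin2024HK, Thm. 2.3 with Thm. 4.3 / Prop. 4.4] -/
theorem ED_ED_le_ED_diag_of_pairCopositive (D : Finset ι) {p : ι → ℝ} (hp0 : ∀ i, 0 ≤ p i)
    (hp1 : ∀ i, p i ≤ 1) {κ : Type*} [Preorder κ] (A : κ → κ → ℝ) (hA : PairCopositive ι A) :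
    ∀ π : Finset ι → κ, (∀ ⦃x y : Finset ι⦄, x ⊆ y → π x ≤ π y) →
      ED D p (fun S => ED D p (fun T => A (π S) (π T))) ≤ ED D p (fun S => A (π S) (π S)) := by
  induction D using Finset.induction_on with
  | empty =>
    intro π _
    simp only [ED_empty, le_refl]
  | @insert e D' he ih =>
    intro π hπ
    set q : ℝ := p e with hq
    have hq0 : 0 ≤ q := hp0 e
    have hq1 : 0 ≤ 1 - q := sub_nonneg.2 (hp1 e)
    set g : Finset ι → Finset ι → ℝ := fun S T => A (π S) (π T) with hg
    set X00 : ℝ := ED D' p (fun S => ED D' p (fun T => g S T)) with hX00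
    set X01 : ℝ := ED D' p (fun S => ED D' p (fun T => g S (insert e T))) with hX01
    set X10 : ℝ := ED D' p (fun S => ED D' p (fun T => g (insert e S) T)) with hX10
    set X11 : ℝ := ED D' p (fun S => ED D' p (fun T => g (insert e S) (insert e T))) with hX11
    set Y0 : ℝ := ED D' p (fun S => g S S) with hY0
    set Y1 : ℝ := ED D' p (fun S => g (insert e S) (insert e S)) with hY1
    have hL : ED (insert e D') p (fun S => ED (insert e D') p (fun T => g S T)) =
        (1 - q) * ((1 - q) * X00 + q * X01) + q * ((1 - q) * X10 + q * X11) := by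
      rw [ED_insert p he]
      have h1 : (fun S => ED (insert e D') p (fun T => g S T)) =
          fun S => (1 - q) * ED D' p (fun T => g S T) + q * ED D' p (fun T => g S (insert e T)) := by
        funext S; rw [ED_insert p he]
      have h2 : (fun S => ED (insert e D') p (fun T => g (insert e S) T)) =
          fun S => (1 - q) * ED D' p (fun T => g (insert e S) T) +
            q * ED D' p (fun T => g (insert e S) (insert e T)) := by
        funext S; rw [ED_insert p he]
      rw [h1, h2, ED_add, ED_add, ED_mul_left, ED_mul_left, ED_mul_left, ED_mul_left]
    have hR : ED (insert e D') p (fun S => g S S) = (1 - q) * Y0 + q * Y1 := by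
      rw [ED_insert p he]
    -- the copositivity condition: mixed sections are dominated IN SUM by the pure ones
    have hK : X01 + X10 ≤ X00 + X11 := by
      have e1 : X01 + X10 =
          ED D' p (fun S => ED D' p (fun T => g S (insert e T) + g (insert e S) T)) := by
        rw [hX01, hX10, ← ED_add]
        congr 1; funext S; rw [← ED_add]
      have e2 : X00 + X11 =
          ED D' p (fun S => ED D' p (fun T => g S T + g (insert e S) (insert e T))) := by
        rw [hX00, hX11, ← ED_add]
        congr 1; funext S; rw [← ED_add]
      have hdiff : ED D' p (fun S => ED D' p (fun T => g S T + g (insert e S) (insert e T))) -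
          ED D' p (fun S => ED D' p (fun T => g S (insert e T) + g (insert e S) T)) =
          ∑ S ∈ D'.powerset, ∑ T ∈ D'.powerset, wtW D' p S * wtW D' p T *
            (A (π S) (π T) + A (π (insert e S)) (π (insert e T)) -
              A (π S) (π (insert e T)) - A (π (insert e S)) (π T)) := by
        unfold ED
        rw [← Finset.sum_sub_distrib]
        refine Finset.sum_congr rfl fun S _ => ?_
        rw [← mul_sub, ← Finset.sum_sub_distrib, Finset.mul_sum]
        refine Finset.sum_congr rfl fun T _ => ?_
        simp only [hg]
        ring
      have hpos := hA D'.powerset (wtW D' p) π (fun S => π (insert e S))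
        (fun S _ => wtW_nonneg D' hp0 hp1 S) (fun S _ => hπ (Finset.subset_insert e S))
      rw [e1, e2]
      linarith [hdiff, hpos]
    have hI0 : X00 ≤ Y0 := ih π hπ
    have hI1 : X11 ≤ Y1 :=
      ih (fun S => π (insert e S)) (fun x y hxy => hπ (Finset.insert_subset_insert e hxy))
    change ED (insert e D') p (fun S => ED (insert e D') p (fun T => g S T)) ≤
      ED (insert e D') p (fun S => g S S)
    rw [hL, hR]
    have h1 : (1 - q) * q * (X01 + X10) ≤ (1 - q) * q * (X00 + X11) :=
      mul_le_mul_of_nonneg_left hK (mul_nonneg hq1 hq0)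
    have h2 : (1 - q) * X00 ≤ (1 - q) * Y0 := mul_le_mul_of_nonneg_left hI0 hq1
    have h3 : q * X11 ≤ q * Y1 := mul_le_mul_of_nonneg_left hI1 hq0
    nlinarith [h1, h2, h3]

/-- **The two-copy inequality with the sums written out**, copositive form. [cite: GladkovZimin2024HK, Thm. 2.3 / 4.3] -/
theorem kernel_sum_sum_le_sum_of_pairCopositive (D : Finset ι) {p : ι → ℝ} (hp0 : ∀ i, 0 ≤ p i)
    (hp1 : ∀ i, p i ≤ 1) {κ : Type*} [Preorder κ] (π : Finset ι → κ)
    (hπ : ∀ ⦃x y : Finset ι⦄, x ⊆ y → π x ≤ π y) (A : κ → κ → ℝ) (hA : PairCopositive ι A) :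
    ∑ S ∈ D.powerset, ∑ T ∈ D.powerset, wtW D p S * wtW D p T * A (π S) (π T) ≤
      ∑ S ∈ D.powerset, wtW D p S * A (π S) (π S) := by
  have h := ED_ED_le_ED_diag_of_pairCopositive D hp0 hp1 A hA π hπ
  unfold ED at h
  have hrw : ∀ S ∈ D.powerset,
      wtW D p S * ∑ T ∈ D.powerset, wtW D p T * A (π S) (π T) =
        ∑ T ∈ D.powerset, wtW D p S * wtW D p T * A (π S) (π T) := by
    intro S _
    rw [Finset.mul_sum]
    exact Finset.sum_congr rfl fun T _ => by ring
  rw [Finset.sum_congr rfl hrw] at h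
  exact h

/-- **Gladkov–Zimin's HK-type inequality on class masses, copositive form** (Thm. 2.3 upgraded by Thm. 4.3 /
Prop. 4.4).  For the class masses `m_a` of a `⊆`-monotone labelling `π` into a preorder and a kernel `A`
that is pair-copositive along the cube (e.g. by `pairCopositive_of_gram`: pair kernel = PSD + nonnegative):
`Σ_{a,b ∈ t} A a b · m_a m_b ≤ Σ_{a ∈ t} A a a · m_a` for every finite `t` containing all labels of
configurations `S ⊆ D`. [cite: GladkovZimin2024HK, Thm. 2.3, Thm. 4.3, Prop. 4.4] -/
theorem kernel_classMass_le_of_pairCopositive (D : Finset ι) {p : ι → ℝ} (hp0 : ∀ i, 0 ≤ p i)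
    (hp1 : ∀ i, p i ≤ 1) {κ : Type*} [Preorder κ] [DecidableEq κ] (π : Finset ι → κ)
    (hπ : ∀ ⦃x y : Finset ι⦄, x ⊆ y → π x ≤ π y) (t : Finset κ) (ht : ∀ S ∈ D.powerset, π S ∈ t)
    (A : κ → κ → ℝ) (hA : PairCopositive ι A) :
    ∑ a ∈ t, ∑ b ∈ t, A a b * (classMass D p π a * classMass D p π b) ≤
      ∑ a ∈ t, A a a * classMass D p π a := by
  have h := kernel_sum_sum_le_sum_of_pairCopositive D hp0 hp1 π hπ A hA
  rw [sum_wtW_mul_comp_eq_sum_classMass D p π t ht (fun a => A a a)] at h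
  have hinner : ∀ S ∈ D.powerset,
      ∑ T ∈ D.powerset, wtW D p S * wtW D p T * A (π S) (π T) =
        wtW D p S * ∑ b ∈ t, A (π S) b * classMass D p π b := by
    intro S _
    rw [← sum_wtW_mul_comp_eq_sum_classMass D p π t ht (fun b => A (π S) b), Finset.mul_sum]
    exact Finset.sum_congr rfl fun T _ => by ring
  rw [Finset.sum_congr rfl hinner,
    sum_wtW_mul_comp_eq_sum_classMass D p π t ht (fun a => ∑ b ∈ t, A a b * classMass D p π b)] at h
  calc ∑ a ∈ t, ∑ b ∈ t, A a b * (classMass D p π a * classMass D p π b)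
      = ∑ a ∈ t, (∑ b ∈ t, A a b * classMass D p π b) * classMass D p π a := by
        refine Finset.sum_congr rfl fun a _ => ?_
        rw [Finset.sum_mul]
        exact Finset.sum_congr rfl fun b _ => by ring
    _ ≤ ∑ a ∈ t, A a a * classMass D p π a := h

end DecisionTree

end Literature.Probability.Percolation

end
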